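import Mathlib

/-!
# `Balaban1983to89.B8SectDSource` — the Sect. D contraction of B8 (pp. 92–94, Proposition 5) and its stability
under a source term (Sect. H, Theorem 8, "by inspection"), kernel-checked as abstract Banach-space lemmas

statement-level skeleton of published theorems with citation tags; proofs where landed; nothing here is a claim
about the Yang–Mills mass gap

CITATION HEADER (lean-in-tree rule 2026-08-18). Reproduction, at the level of abstract complex-Banach-space
lemmas with the PRINTED bounds as named hypotheses, of the contraction argument (1.100)–(1.106) and of the
existence clause (1.107)–(1.108) of Proposition 5 of T. Bałaban, *Spaces of regular gauge field configurations on
a lattice and gauge fixing conditions*, Comm. Math. Phys. **99**, 75–102 (1985) [Balaban1985RegularSpaces] (cell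
paper B8; PDF held `paper:balaban1985-cmp99-regular-spaces-gauge-fixing`, journal page = PDF page + 74; renders of
pp. 92, 93, 94, 101 checked 2026-08-18), together with the Sect. H sentence by which Theorem 8 (gauge condition
with a source `f`, (1.146)) is obtained from the same proof.  The paper is a manuscript UNDER ADJUDICATION by the
audit cell `pub-balaban`; nothing of it is asserted here.  Every theorem below is an elementary, sorry-free
statement about maps between complete normed spaces; the lattice content of B8 enters only through the NAMES of
the hypotheses ((1.98), (1.99), `‖G′‖ ≤ B′₀`, `|RD*A|₍₋₂₎ ≤ B₁(α₀+α₁)`, `|f|₍₋₂₎ ≤ γ(α₀+α₁)`), which a reader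
must still discharge from the printed text (they are the inputs the cell's census lists for C-B8-11 / G-B8-08).
Sibling modules: `B8` (statement layer; `B8.contraction_constant` is the arithmetic of p. 94 l. 9 only),
`B8SectE` (the "onto" step of p. 97 behind the uniqueness clause (1.109)), `B8Ineq125` (the Cauchy estimate (1.125)),
`B8SectGH` (Theorems 3′, 4′, 8 as printed, statement layer).  This file imports none of them (Mathlib only).

WHAT IS PRINTED.  p. 92: "Let us recall that from Theorems 3.1, 3.2 of [4] it follows that |Rf| ≤ B′₀|f|, hence
the operator R[...]R has a L^∞ norm bounded by O(α₄)B′₀². We assume that α₄ is so small that O(α₄)B′₀² ≤ ½. Then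
the operator in the square bracket in (1.94) is invertible."; "(I + RVR)⁻¹ = I + Σ_{n=1}^∞ (−1)ⁿ(RVR)ⁿ = I +
Σ_{n=1}^∞ (−1)ⁿR(VR)ⁿ. (1.96)"; "|Rf|₍₋₂₎ ≤ B′₀|f|₍₋₂₎, |Vf|₍₋₂₎ ≤ O(α₄)|f|₍₋₂₎. (1.98)".  p. 93: "|R𝔉₄(λ, Dλ, A,
D*A)| ≤ C′₄B₁(α₀+α₁)α₄(L^jη)⁻² on Ω_j (1.99) for j < k."; "λ = G′RD*A + G′R𝔉₄(λ, Dλ, A, D*A). (1.100)"; "One of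
the results of [4], Theorem 3.1, tells us that G′ is a bounded operator from a space with the norm |·|₍₋₂₎ into a
space with the norm |·| for functions, and the norm |·|₍₋₁₎ for their first derivatives. Thus we have |𝔉(λ)| ≤
B′₀B₁(α₀+α₁) + B′₀C′₄B₁(α₀+α₁)α₄, |D𝔉(λ)| ≤ (B′₀B₁(α₀+α₁) + B′₀C′₄B₁(α₀+α₁)α₄)(L^jη)⁻¹ on Ω_j, (1.101) if λ
belongs to the space {λ : |λ| < βα₄, |Dλ| < βα₄(L^jη)⁻¹ on Ω_j, j = 0, 1, …, k−1}, β ≤ ½, or simply {λ : |λ|,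
|Dλ|₍₋₁₎ < βα₄}. (1.102) The function 𝔉 is obviously an analytic function in λ and we consider configurations λ
with values in the complexified algebra. The function 𝔉 maps the domain (1.102) into itself if C′₄α₄ ≤ 1 and
B′₀(1 + C′₄α₄)B₁(α₀+α₁) ≤ 2B′₀B₁(α₀+α₁) ≤ βα₄, hence if α₄ ≤ 1/C′₄, α₀+α₁ ≤ (1/(2B′₀B₁))βα₄. (1.103)".  p. 94:
"Let us take λ₁, λ₂ from the domain (1.102) with β = ¼ and let us apply the Cauchy formula for the derivative of
the analytic function in τ above. … (1.105) with r = (4 max{|λ₁−λ₂|, |Dλ₁−Dλ₂|₍₋₁₎})⁻¹α₄. The argument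
tλ₁ + (1−t)λ₂ + τ(λ₁−λ₂) belongs to the domain (1.102) with β = ½, and we use the inequality (1.99). We get
|𝔉(λ₁) − 𝔉(λ₂)|, |D(𝔉(λ₁) − 𝔉(λ₂))|₍₋₁₎ ≤ B′₀C′₄B₁(α₀+α₁) 4 max{|λ₁−λ₂|, |Dλ₁−Dλ₂|₍₋₁₎}, (1.106) and by (1.103)
4C′₄B′₀B₁(α₀+α₁) ≤ 2C′₄βα₄ = ½C′₄α₄ ≤ ½ for β = ¼. Thus the transformation 𝔉 maps the domain (1.102) with β = ¼
into itself and is contractive if the inequality (1.103) holds with β = ¼. The contraction mapping theorem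
implies that there exists a unique fixed point of this transformation in the considered domain. To get a best
uniqueness result we have to take a largest possible α₄. It is independent of α₀ + α₁. To get best bounds on the
solution we have to take a smallest possible α₄, hence α₄ = 8B′₀B₁(α₀+α₁), and then we have to assume that
α₀ + α₁ is so small that all the conditions on α₀ + α₁, α₄ are satisfied."; Proposition 5: "There exist positive
constants c₂, c₃, depending on d and L only, such that … if α₀ + α₁ ≤ c₂, then there exists a configuration
u′ = e^{iλ} satisfying the equations RD*(1/iη) log U₁^{u′⁻¹} = 0, R₀u′u₁^j‾ = 1 on Λ_j, j = 0, 1, …, k (1.107)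
and the bounds |λ|, |Dλ|₍₋₁₎ < 8B′₀B₁(α₀+α₁). (1.108) Such a configuration u′ is unique in the domain |λ|,
|Dλ|₍₋₁₎ < c₃. (1.109)".  p. 101 (Sect. H): the gauge condition "R(U₀)D^{η*}_{U₀}A = f, (1.146) where f is a function
from the space R(U₀), i.e. a Lie algebra valued function defined on Ω₀ and satisfying R(U₀)f = f. Of course we
have to assume that f is in a sufficiently small neighborhood of 0, for example it is enough to assume that
|f|₍₋₂₎ < γ(α₀+α₁) with a positive, not too big, constant γ, e.g. γ = 1. Inspecting the proofs of the theorems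
and propositions we can see easily that they work in this more general situation almost without any changes,
only some constants change their numerical values. Thus we have the following generalization of Theorem 2.
Theorem 8. There exist constants B₁, B₂(β₀), c₁ such that … for an arbitrary function f from the space R(U₀)
satisfying the bound |f|₍₋₂₎ < γ(α₀+α₁), there exists exactly one gauge transformation u satisfying (1.29) and
such, that the conditions (1.36), (1.37), (1.39), and (1.146) hold for the configuration U₁ = U′^{u⁻¹}. The
constants B₁, B₂(β₀) are as in Theorems 2, 4, the constant c₁ depends on d, L and γ."

WHAT IS NOT PRINTED.  (a) The contraction mapping theorem is invoked on the OPEN domain (1.102) (β = ¼) while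
(1.101), (1.103) are non-strict: `‖𝔉(λ)‖ ≤ ¼α₄` does not place `𝔉(λ)` in the open domain, and at Bałaban's own
choice `α₄ = 8B′₀B₁(α₀+α₁)` the second inequality of (1.103) is an equality.  In the closed-ball reading adopted
below (`‖λᵢ‖ ≤ ¼α₄`) the Cauchy circle `|τ| = r` of (1.105) may touch `‖·‖ = ½α₄`, so (1.106) is proved via circles
of radius `r′ < r` and a limit; in print's open domain the argument `tλ₁ + (1−t)λ₂ + τ(λ₁−λ₂)` is strictly inside
the β = ½ domain and no such issue arises (GAPS G-pv13g2-4 (1): the v1 sentence asserting a boundary contact IN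
PRINT, and cell row G-B8-17 (b), are withdrawn by that counter).  Typed reading (DIVERGENCE D-b08-g4.1): the fixed
point is sought in the CLOSED ball `‖λ‖ ≤ ¼α₄`, (1.106) on it from (1.99) on the OPEN β = ½ ball — no new input,
same constants.
(b) λ is complexified (p. 93) but the solution must be real: the fixed point of a contraction preserving a closed
subspace containing `0` lies in it (`fixedPoint_mem_of_invariant`).  (c) Sect. H gives no formula for the changed
constants; with the source the right side of (1.95) acquires `f̃(λ) := (I + RV(λ)R)⁻¹f` (which lies in Range R, so
`Q′G′f̃ = 0` and (1.100) still reproduces both equations (1.95)), and (1.100) becomes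
`λ = G′f̃(λ) + G′RD*A + G′R𝔉₄(λ, …)`; the constants that change are made explicit below.

WHAT THIS FILE PROVES (`E`, `F` complex Banach spaces; in B8, `E` = complexified λ-configurations with the norm
`max{|λ|, |Dλ|₍₋₁₎}` of (1.102), `F` = functions with the norm `|·|₍₋₂₎`; `s` := α₀ + α₁):
* §1 `fixedPoint_closedBall`, `norm_fixedPoint_le`, `fixedPoint_mem_of_invariant` — Banach's theorem on a closed
  ball, the a-posteriori bound, and (b).
* §2 `norm_fderiv_le_of_norm_le`, `lipschitz_of_norm_le` — the Cauchy estimate behind (1.104)–(1.106): an analytic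
  map bounded by `M` on the open ball of radius `R` is `M/(R − ρ)`-Lipschitz on the closed ball of radius `ρ < R`
  (`R = ½α₄`, `ρ = ¼α₄`, `M = C′₄B₁sα₄` give the printed factor `4C′₄B₁s`).
* §3 `isUnit_one_add`, `inverse_one_add_eq_tsum` ((1.96)), `norm_inverse_one_add_le`,
  `norm_inverse_one_add_apply_le`, `norm_inverse_one_add_apply_sub_le`, `differentiableAt_inverse_one_add_apply` —
  the Neumann inversion of p. 92 with `‖(I+T)⁻¹‖ ≤ 1/(1−θ)`, `‖(I+T)⁻¹f − f‖ ≤ θ‖f‖/(1−θ)`, analytic in λ.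
* §4 `ineq1101`, `ineq1106`, `contraction_le_half`, `propFive_fixedPoint`, `propFive_choice` — (1.101), (1.106),
  p. 94 l. 9, and the existence-uniqueness of the fixed point of (1.100) in `‖λ‖ ≤ ¼α₄` with `‖λ‖ ≤ 2B′₀B₁s`, at
  `α₄ = 8B′₀B₁s` the bound (1.108) `< 8B′₀B₁s` — from the hypotheses `‖G′‖ ≤ B′₀`, `‖RD*A‖ ≤ B₁s`, analyticity of
  `R𝔉₄` with (1.99) on the β = ½ ball, and (1.103) (β = ¼) in the printed form `C′₄α₄ ≤ 1`, `2B′₀B₁s ≤ ¼α₄`.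
* §5 `propFive_source`, `thm8_sectD_inspected` — THE INSPECTION: the same argument with the source term
  `N(λ) = (I + RV(λ)R)⁻¹f`, `‖R‖ ≤ B′₀`, `‖V(λ)‖ ≤ c_Vα₄` (1.98), `‖f‖ ≤ γs`; it closes for EVERY `γ ≥ 0` under the
  changed constants `θ = B′₀²c_Vα₄ ≤ ¼` (printed ½), `C′₄α₄ ≤ ½` (printed 1), `α₄ = 8B′₀(B₁+γ)s` (printed
  `8B′₀B₁s`), giving a unique fixed point with `‖λ‖ ≤ 2B′₀(B₁+γ)s < 8B′₀(B₁+γ)s` — (1.108) with `B₁ ↦ B₁ + γ`; the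
  three smallness conditions are conditions on `s` with γ-dependent thresholds ("c₁ depends on d, L and γ").
* §6 `apriori_160_source`, `apriori_162_source`, `apriori_162_gamma` — the Sect. B–C side: IF the source enters
  the a-priori bound (1.59) additively as `B₀φ` (shape hypothesised, not printed), the bootstrap (1.60) carries
  `+2φ` and the printed `B₁ = 5dLB₀` of (1.62) is unchanged exactly when `2φ ≤ (dL−1)s`; for `φ = cγs` this reads
  `2cγ ≤ dL − 1` — a precise sense of "γ not too big" compatible with "B₁ as in Theorems 2, 4".
NOT covered (and not claimed): the ∇- and Hölder clauses of (1.36) for Theorem 8, which the cell's census records as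
NOT following for a source with only `|f|₍₋₂₎` small (GAPS G-B8-13); the discharge of (1.98), (1.99) themselves.

Unit `b2b-balaban-b08-g4` (paper sub-cell B08, generation 4).  Census rows: GAPS.md C-B8-21 (certification of
(1.100)–(1.108) and of the Sect. D part of Theorem 8 modulo the named printed inputs, with the explicit changed
constants), G-B8-17 (remarks (a), (b); its Cauchy-circle clause withdrawn, G-pv13g2-4), C-B8-22 (§6); DIVERGENCE.md
D-b08-g4.1 (abstract typing, closed-ball reading).  XREAD: C-pv13g2-16 (pv13-g2).
REVISION v1.1 (unit `b2b-balaban-b08-g5`, generation 5, 2026-08-18; DOCSTRING-ONLY, no declaration touched — GAPS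
G-pv13g2-4 items (1)–(3)): (1) "WHAT IS NOT PRINTED (a)", second sentence re-worded — in print λ₁, λ₂ lie in the
OPEN β = ¼ domain, so the Cauchy-circle argument of (1.105) is strictly inside the β = ½ domain and (1.99) applies
on the whole circle; the boundary contact is an artefact of this module's closed-ball reading only; (2) the §6
docstring of `apriori_160_source` now quotes the p. 86 bootstrap sentence verbatim; (3) (1.146) quoted with the
printed superscript, `R(U₀)D^{η*}_{U₀}A = f`.
Value: kernel-checked bookkeeping of a printed "by inspection", NOT summit progress.
REVISION v1.2 (lit-balaban r05, 2026-08-20; DOCSTRING-ONLY, no declaration touched): locator tags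
`[cite: Balaban1985RegularSpaces, …]` added to every declaration docstring (SKELETON rows B8.Eq1.90, B8.Eq1.99,
B8.Eq1.101, B8.Eq1.106, B8.Prop5; MISSING-SOURCES §C.2: the declaration a row rests on carries the row's locator).
The tags locate the PRINTED display each abstract lemma reproduces; readings and repairs remain as stated.
REVISION v1.3 (lit-balaban r05 gen 3, 2026-08-21; DOCSTRING-ONLY): the skeleton's framing line moved to page 1 of
this module docstring (REFEREE-3 §16/§21 framing lint reads the first 6000 characters); nothing else changed.
-/

noncomputable section

namespace Literature.MathematicalPhysics.QuantumFieldTheory.Balaban1983to89.B8SectDSource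

open Set Metric Filter Topology
open scoped Ring NNReal

/-! ## §1. "The contraction mapping theorem implies that there exists a unique fixed point of this
transformation in the considered domain" (p. 94, l. 10–12) — Banach's theorem on a closed ball. -/

section Banach

variable {E : Type*} [NormedAddCommGroup E]

/-- Banach's fixed point theorem on the closed ball `‖x‖ ≤ ρ` of a complete normed group: a self-map of the ball
which is `κ`-Lipschitz there with `κ < 1` has exactly one fixed point in the ball.  (B8 p. 94: "The contraction
mapping theorem implies that there exists a unique fixed point of this transformation in the considered domain.")
Elementary API (Banach) for that sentence. [cite: Balaban1985RegularSpaces, p.94 (after (1.106)); domain (1.102)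
p.93 (closed-ball reading)] -/
theorem fixedPoint_closedBall [CompleteSpace E] (frF : E → E) {ρ κ : ℝ} (hρ : 0 ≤ ρ) (hκ0 : 0 ≤ κ)
    (hκ1 : κ < 1)
    (hmaps : ∀ x : E, ‖x‖ ≤ ρ → ‖frF x‖ ≤ ρ)
    (hlip : ∀ x y : E, ‖x‖ ≤ ρ → ‖y‖ ≤ ρ → ‖frF x - frF y‖ ≤ κ * ‖x - y‖) :
    ∃! x : E, ‖x‖ ≤ ρ ∧ frF x = x := by
  have hmaps' : MapsTo frF (closedBall (0 : E) ρ) (closedBall 0 ρ) := fun x hx => by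
    rw [mem_closedBall_zero_iff] at hx ⊢
    exact hmaps x hx
  have hcontr : ContractingWith (Real.toNNReal κ)
      (hmaps'.restrict frF (closedBall 0 ρ) (closedBall 0 ρ)) := by
    refine ⟨Real.toNNReal_lt_one.2 hκ1, LipschitzWith.of_dist_le_mul fun x y => ?_⟩
    have h := hlip x y (mem_closedBall_zero_iff.1 x.2) (mem_closedBall_zero_iff.1 y.2)
    simp only [Subtype.dist_eq, dist_eq_norm, MapsTo.val_restrict_apply, Real.coe_toNNReal κ hκ0]
    exact h
  obtain ⟨x, hxmem, hfix, -⟩ := hcontr.exists_fixedPoint' isClosed_closedBall.isComplete hmaps'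
    (mem_closedBall_self hρ) (edist_ne_top _ _)
  refine ⟨x, ⟨mem_closedBall_zero_iff.1 hxmem, hfix.eq⟩, fun y hy => ?_⟩
  obtain ⟨hy, hyfix⟩ := hy
  have h := hlip y x hy (mem_closedBall_zero_iff.1 hxmem)
  rw [hyfix, hfix.eq] at h
  have hn : ‖y - x‖ = 0 := by nlinarith [norm_nonneg (y - x)]
  exact sub_eq_zero.1 (norm_eq_zero.1 hn)

/-- A posteriori bound: a fixed point in the ball inherits any bound `b` on the image of the ball (used for
(1.108): `‖λ‖ = ‖𝔉(λ)‖ ≤ 2B′₀B₁(α₀+α₁)`).  Elementary API. [cite: Balaban1985RegularSpaces, (1.108) p.94; (1.101)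
p.93] -/
theorem norm_fixedPoint_le (frF : E → E) {ρ b : ℝ} (himg : ∀ x : E, ‖x‖ ≤ ρ → ‖frF x‖ ≤ b)
    {x : E} (hx : ‖x‖ ≤ ρ) (hfix : frF x = x) : ‖x‖ ≤ b := by
  have := himg x hx
  rwa [hfix] at this

/-- The fixed point lies in every closed `𝔉`-invariant subset of the ball containing `0` — e.g. the REAL
configurations inside the complexified ones (p. 93: "we consider configurations λ with values in the complexified
algebra"; the solution λ of (1.100) is nevertheless real because 𝔉 preserves real configurations).  Elementary
API for that remark. [cite: Balaban1985RegularSpaces, p.93 (after (1.102)); (1.100) p.93] -/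
theorem fixedPoint_mem_of_invariant [CompleteSpace E] (frF : E → E) {ρ κ : ℝ} (hρ : 0 ≤ ρ) (hκ0 : 0 ≤ κ)
    (hκ1 : κ < 1)
    (hmaps : ∀ x : E, ‖x‖ ≤ ρ → ‖frF x‖ ≤ ρ)
    (hlip : ∀ x y : E, ‖x‖ ≤ ρ → ‖y‖ ≤ ρ → ‖frF x - frF y‖ ≤ κ * ‖x - y‖)
    (S : Set E) (hS : IsClosed S) (h0 : (0 : E) ∈ S) (hinv : ∀ x ∈ S, ‖x‖ ≤ ρ → frF x ∈ S)
    {x : E} (hx : ‖x‖ ≤ ρ) (hfix : frF x = x) : x ∈ S := by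
  set D : Set E := S ∩ closedBall (0 : E) ρ with hD
  have hmapsD : MapsTo frF D D := by
    intro y hy
    rcases hy with ⟨hyS, hyB⟩
    rw [mem_closedBall_zero_iff] at hyB
    exact ⟨hinv y hyS hyB, mem_closedBall_zero_iff.2 (hmaps y hyB)⟩
  have hcontr : ContractingWith (Real.toNNReal κ) (hmapsD.restrict frF D D) := by
    refine ⟨Real.toNNReal_lt_one.2 hκ1, LipschitzWith.of_dist_le_mul fun y z => ?_⟩
    have h := hlip y z (mem_closedBall_zero_iff.1 y.2.2) (mem_closedBall_zero_iff.1 z.2.2)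
    simp only [Subtype.dist_eq, dist_eq_norm, MapsTo.val_restrict_apply, Real.coe_toNNReal κ hκ0]
    exact h
  have hDc : IsComplete D := (hS.inter isClosed_closedBall).isComplete
  obtain ⟨y, hymem, hyfix, -⟩ := hcontr.exists_fixedPoint' hDc hmapsD
    (show (0 : E) ∈ D from ⟨h0, mem_closedBall_self hρ⟩) (edist_ne_top _ _)
  -- uniqueness in the ball identifies `x` with `y ∈ S`
  have hyB : ‖y‖ ≤ ρ := mem_closedBall_zero_iff.1 hymem.2
  have h := hlip x y hx hyB
  rw [hfix, hyfix.eq] at h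
  have hn : ‖x - y‖ = 0 := by nlinarith [norm_nonneg (x - y)]
  have hxy : x = y := sub_eq_zero.1 (norm_eq_zero.1 hn)
  rw [hxy]
  exact hymem.1

end Banach

/-! ## §2. "(1.104) … apply the Cauchy formula for the derivative of the analytic function in τ … (1.105) with
r = (4 max{|λ₁−λ₂|, |Dλ₁−Dλ₂|₍₋₁₎})⁻¹ α₄ … we use the inequality (1.99). We get (1.106)" (p. 93 l. −6 – p. 94 l. 9):
an analytic map bounded by `M` on the ball of radius `R` is `M/(R − ρ)`-Lipschitz on the closed ball of radius
`ρ < R`. -/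

section Cauchy

variable {E F : Type*} [NormedAddCommGroup E] [NormedSpace ℂ E] [NormedAddCommGroup F] [NormedSpace ℂ F]

/-- Cauchy estimate for the Fréchet derivative (the kernel form of (1.105)): if `Φ` is complex-differentiable on the
open ball `‖z‖ < R` and `‖Φ z‖ ≤ M` there, then `‖DΦ(x)‖ ≤ M/(R − ‖x‖)` for `‖x‖ < R`.  Proof: for a direction `v`,
the one-variable function `τ ↦ Φ(x + τv)` is analytic on every closed disc `|τ| ≤ r′` with `‖x‖ + r′‖v‖ < R`, so
Cauchy's estimate (`Complex.norm_deriv_le_of_forall_mem_sphere_norm_le`) gives `‖DΦ(x)v‖ ≤ M/r′`; let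
`r′ ↑ (R − ‖x‖)/‖v‖`.  The printed source is the Cauchy formula (1.105) (and (1.124) in Sect. E).
[cite: Balaban1985RegularSpaces, (1.105) p.94; (1.124) p.97] -/
theorem norm_fderiv_le_of_norm_le {Φ : E → F} {R M : ℝ}
    (hd : DifferentiableOn ℂ Φ (ball (0 : E) R)) (hM : ∀ z ∈ ball (0 : E) R, ‖Φ z‖ ≤ M)
    {x : E} (hx : ‖x‖ < R) : ‖fderiv ℂ Φ x‖ ≤ M / (R - ‖x‖) := by
  have hRx : 0 < R - ‖x‖ := sub_pos.2 hx
  have hxball : x ∈ ball (0 : E) R := mem_ball_zero_iff.2 hx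
  have hM0 : 0 ≤ M := (norm_nonneg _).trans (hM x hxball)
  refine ContinuousLinearMap.opNorm_le_bound _ (div_nonneg hM0 hRx.le) fun v => ?_
  rcases eq_or_ne v 0 with rfl | hv
  · simp
  have hv' : 0 < ‖v‖ := norm_pos_iff.2 hv
  have hxd : DifferentiableAt ℂ Φ x := hd.differentiableAt (isOpen_ball.mem_nhds hxball)
  -- the directional derivative `DΦ(x)v` is the derivative at `0` of `τ ↦ Φ (x + τ • v)`
  have hg0 : HasDerivAt (fun τ : ℂ => Φ (x + τ • v)) (fderiv ℂ Φ x v) 0 := by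
    have h1 : HasDerivAt (fun τ : ℂ => x + τ • v) ((1 : ℂ) • v) 0 :=
      ((hasDerivAt_id (0 : ℂ)).smul_const v).const_add x
    have h2 : HasFDerivAt Φ (fderiv ℂ Φ x) (x + (0 : ℂ) • v) := by
      rw [zero_smul, add_zero]
      exact hxd.hasFDerivAt
    have h3 := h2.comp_hasDerivAt (0 : ℂ) h1
    simpa [Function.comp_def, one_smul] using h3
  -- Cauchy's estimate on every admissible disc
  have key : ∀ r' : ℝ, 0 < r' → ‖x‖ + r' * ‖v‖ < R → ‖fderiv ℂ Φ x v‖ ≤ M / r' := by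
    intro r' hr' hr'R
    have hdisc : ∀ τ : ℂ, ‖τ‖ ≤ r' → x + τ • v ∈ ball (0 : E) R := by
      intro τ hτ
      rw [mem_ball_zero_iff]
      calc ‖x + τ • v‖ ≤ ‖x‖ + ‖τ • v‖ := norm_add_le _ _
        _ = ‖x‖ + ‖τ‖ * ‖v‖ := by rw [norm_smul]
        _ ≤ ‖x‖ + r' * ‖v‖ := by gcongr
        _ < R := hr'R
    have hga : ∀ τ : ℂ, ‖τ‖ ≤ r' → DifferentiableAt ℂ (fun τ : ℂ => Φ (x + τ • v)) τ := by
      intro τ hτ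
      have hΦ : DifferentiableAt ℂ Φ (x + τ • v) :=
        hd.differentiableAt (isOpen_ball.mem_nhds (hdisc τ hτ))
      have hp : DifferentiableAt ℂ (fun τ : ℂ => x + τ • v) τ :=
        (differentiableAt_id.smul_const v).const_add x
      exact hΦ.comp τ hp
    have hdc : DiffContOnCl ℂ (fun τ : ℂ => Φ (x + τ • v)) (ball (0 : ℂ) r') := by
      constructor
      · intro τ hτ
        exact (hga τ (mem_ball_zero_iff.1 hτ).le).differentiableWithinAt
      · intro τ hτ
        rw [closure_ball (0 : ℂ) hr'.ne'] at hτ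
        exact (hga τ (mem_closedBall_zero_iff.1 hτ)).continuousAt.continuousWithinAt
    have hsph : ∀ τ ∈ sphere (0 : ℂ) r', ‖Φ (x + τ • v)‖ ≤ M := fun τ hτ =>
      hM _ (hdisc τ (mem_sphere_zero_iff_norm.1 hτ).le)
    have hc := Complex.norm_deriv_le_of_forall_mem_sphere_norm_le hr' hdc hsph
    rwa [hg0.deriv] at hc
  -- pass to the limit `r' ↑ (R − ‖x‖)/‖v‖`
  refine le_of_forall_gt_imp_ge_of_dense fun ε hε => ?_
  have hq : 0 ≤ M / (R - ‖x‖) * ‖v‖ := by positivity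
  have hε0 : 0 < ε := lt_of_le_of_lt hq hε
  rcases hM0.eq_or_lt with hM00 | hMpos
  · -- `M = 0`
    have hr : 0 < (R - ‖x‖) / (2 * ‖v‖) := by positivity
    have hin : ‖x‖ + (R - ‖x‖) / (2 * ‖v‖) * ‖v‖ < R := by
      have : (R - ‖x‖) / (2 * ‖v‖) * ‖v‖ = (R - ‖x‖) / 2 := by
        field_simp
      rw [this]
      linarith
    have h := key _ hr hin
    rw [← hM00, zero_div] at h
    exact h.trans hε0.le
  · -- `M > 0`: radius `r' := M/ε`
    have hMne : M ≠ 0 := hMpos.ne'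
    have hεne : ε ≠ 0 := hε0.ne'
    have hr : 0 < M / ε := div_pos hMpos hε0
    have h1 : M * ‖v‖ < ε * (R - ‖x‖) := by
      have h' : M / (R - ‖x‖) * ‖v‖ < ε := hε
      rw [div_mul_eq_mul_div, div_lt_iff₀ hRx] at h'
      linarith
    have hin : ‖x‖ + M / ε * ‖v‖ < R := by
      have h' : M / ε * ‖v‖ < R - ‖x‖ := by
        rw [div_mul_eq_mul_div, div_lt_iff₀ hε0]
        linarith
      linarith
    have h := key _ hr hin
    have hsimp : M / (M / ε) = ε := by
      field_simp
    rw [hsimp] at h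
    exact h

/-- Mean-value consequence (the kernel form of (1.104)–(1.106)): an analytic map bounded by `M` on the open ball of
radius `R` is `M/(R − ρ)`-Lipschitz on the closed ball of radius `ρ < R`.  With `R = ½α₄`, `ρ = ¼α₄`,
`M = C′₄B₁(α₀+α₁)α₄` [(1.99)] the constant is `4C′₄B₁(α₀+α₁)` — the printed (1.106) before the factor `B′₀` of `G′`.
[cite: Balaban1985RegularSpaces, (1.104)–(1.106) pp.93–94] -/
theorem lipschitz_of_norm_le {Φ : E → F} {R M ρ : ℝ}
    (hd : DifferentiableOn ℂ Φ (ball (0 : E) R)) (hM : ∀ z ∈ ball (0 : E) R, ‖Φ z‖ ≤ M)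
    (hρR : ρ < R) {x y : E} (hx : ‖x‖ ≤ ρ) (hy : ‖y‖ ≤ ρ) :
    ‖Φ x - Φ y‖ ≤ M / (R - ρ) * ‖x - y‖ := by
  have hρ0 : 0 ≤ ρ := (norm_nonneg x).trans hx
  have hR : 0 < R := lt_of_le_of_lt hρ0 hρR
  have hM0 : 0 ≤ M := (norm_nonneg _).trans (hM 0 (mem_ball_self hR))
  have hdiff : ∀ z ∈ closedBall (0 : E) ρ, DifferentiableAt ℂ Φ z := fun z hz =>
    hd.differentiableAt (isOpen_ball.mem_nhds
      (mem_ball_zero_iff.2 (lt_of_le_of_lt (mem_closedBall_zero_iff.1 hz) hρR)))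
  have hbound : ∀ z ∈ closedBall (0 : E) ρ, ‖fderiv ℂ Φ z‖ ≤ M / (R - ρ) := by
    intro z hz
    have hz' := mem_closedBall_zero_iff.1 hz
    have h := norm_fderiv_le_of_norm_le hd hM (lt_of_le_of_lt hz' hρR)
    refine h.trans ?_
    exact div_le_div_of_nonneg_left hM0 (by linarith) (by linarith)
  exact (convex_closedBall (0 : E) ρ).norm_image_sub_le_of_norm_fderiv_le hdiff hbound
    (mem_closedBall_zero_iff.2 hy) (mem_closedBall_zero_iff.2 hx)

end Cauchy

/-! ## §3. "(I + RVR)⁻¹ = I + Σ_{n≥1} (−1)ⁿ(RVR)ⁿ" (1.96) and "|Rf|₍₋₂₎ ≤ B′₀|f|₍₋₂₎, |Vf|₍₋₂₎ ≤ O(α₄)|f|₍₋₂₎" (1.98),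
p. 92: the Neumann inversion, its bounds, and its analytic dependence on λ. -/

section Neumann

variable {F : Type*} [NormedAddCommGroup F] [NormedSpace ℂ F] [CompleteSpace F]

/-- p. 92: "We assume that α₄ is so small that O(α₄)B′₀² ≤ ½. Then the operator in the square bracket in (1.94) is
invertible."  For a bounded operator `T` (= RVR) of norm `< 1`, `I + T` is a unit of the operator algebra.
[cite: Balaban1985RegularSpaces, p.92 (between (1.95) and (1.96)); (1.94) p.92] -/
theorem isUnit_one_add (T : F →L[ℂ] F) (hT : ‖T‖ < 1) : IsUnit (1 + T) := by
  have h := isUnit_one_sub_of_norm_lt_one (x := -T) (by rwa [norm_neg])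
  rwa [sub_neg_eq_add] at h

/-- (1.96) verbatim: "(I + RVR)⁻¹ = I + Σ_{n=1}^∞ (−1)ⁿ(RVR)ⁿ" — the inverse is the Neumann series `Σ_{n≥0} (−T)ⁿ`.
[cite: Balaban1985RegularSpaces, (1.96) p.92] -/
theorem inverse_one_add_eq_tsum (T : F →L[ℂ] F) (hT : ‖T‖ < 1) :
    (1 + T)⁻¹ʳ = ∑' n : ℕ, (-T) ^ n := by
  have h := geom_series_eq_inverse (-T) (by rwa [norm_neg])
  rw [sub_neg_eq_add] at h
  exact h.symm

/-- Norm of the Neumann inverse: `‖T‖ ≤ θ < 1 ⇒ ‖(I + T)⁻¹‖ ≤ 1/(1 − θ)` (from `S(I + T) = I`, i.e. `S = I − ST`).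
Elementary API for the step (1.96) ⇒ «gives a term bounded by …» (p.93 l.1–2). [cite: Balaban1985RegularSpaces,
(1.96) p.92; (1.98) p.92] -/
theorem norm_inverse_one_add_le (T : F →L[ℂ] F) {θ : ℝ} (hT : ‖T‖ ≤ θ) (hθ : θ < 1) :
    ‖(1 + T)⁻¹ʳ‖ ≤ 1 / (1 - θ) := by
  set S := (1 + T)⁻¹ʳ with hS
  have hu : IsUnit (1 + T) := isUnit_one_add T (lt_of_le_of_lt hT hθ)
  have h1 : S * (1 + T) = 1 := Ring.inverse_mul_cancel _ hu
  have h2 : S = 1 - S * T := by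
    rw [mul_add, mul_one] at h1
    exact eq_sub_of_add_eq h1
  have hone : ‖(1 : F →L[ℂ] F)‖ ≤ 1 := by
    rw [ContinuousLinearMap.one_def]
    exact ContinuousLinearMap.norm_id_le
  have h3 : ‖S‖ ≤ 1 + ‖S‖ * θ := by
    calc ‖S‖ = ‖1 - S * T‖ := by rw [← h2]
      _ ≤ ‖(1 : F →L[ℂ] F)‖ + ‖S * T‖ := norm_sub_le _ _
      _ ≤ 1 + ‖S‖ * ‖T‖ := add_le_add hone (norm_mul_le _ _)
      _ ≤ 1 + ‖S‖ * θ := by gcongr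
  rw [le_div_iff₀ (by linarith)]
  nlinarith [norm_nonneg S]

/-- First consequence for the source term `f̃ := (I + RVR)⁻¹ f`: `‖f̃‖ ≤ ‖f‖/(1 − θ)`.  Elementary API for the
Sect. H inspection (source `f` of (1.146)). [cite: Balaban1985RegularSpaces, (1.96) p.92; (1.146) p.101] -/
theorem norm_inverse_one_add_apply_le (T : F →L[ℂ] F) {θ : ℝ} (hT : ‖T‖ ≤ θ) (hθ : θ < 1) (f : F) :
    ‖(1 + T)⁻¹ʳ f‖ ≤ ‖f‖ / (1 - θ) := by
  have h := norm_inverse_one_add_le T hT hθ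
  calc ‖(1 + T)⁻¹ʳ f‖ ≤ ‖(1 + T)⁻¹ʳ‖ * ‖f‖ := ContinuousLinearMap.le_opNorm _ _
    _ ≤ 1 / (1 - θ) * ‖f‖ := by gcongr
    _ = ‖f‖ / (1 - θ) := by ring

/-- Second consequence: the λ-DEPENDENT part of the source term is small, `‖f̃ − f‖ ≤ θ‖f‖/(1 − θ)`
(`f̃ − f = −(I + T)⁻¹ T f`).  Elementary API for the Sect. H inspection. [cite: Balaban1985RegularSpaces, (1.96) p.92;
(1.146) p.101] -/
theorem norm_inverse_one_add_apply_sub_le (T : F →L[ℂ] F) {θ : ℝ} (hT : ‖T‖ ≤ θ) (hθ : θ < 1) (f : F) :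
    ‖(1 + T)⁻¹ʳ f - f‖ ≤ θ * ‖f‖ / (1 - θ) := by
  set S := (1 + T)⁻¹ʳ with hS
  have hθ0 : 0 ≤ θ := (norm_nonneg T).trans hT
  have hu : IsUnit (1 + T) := isUnit_one_add T (lt_of_le_of_lt hT hθ)
  have h1 : S * (1 + T) = 1 := Ring.inverse_mul_cancel _ hu
  have h2 : S f + S (T f) = f := by
    have := congrArg (fun A : F →L[ℂ] F => A f) h1
    simpa [map_add] using this
  have h3 : S f - f = -(S (T f)) := by
    have h4 : S f = f - S (T f) := eq_sub_of_add_eq h2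
    rw [h4]
    abel
  have hSn := norm_inverse_one_add_le T hT hθ
  calc ‖S f - f‖ = ‖S (T f)‖ := by rw [h3, norm_neg]
    _ ≤ ‖S‖ * ‖T f‖ := ContinuousLinearMap.le_opNorm _ _
    _ ≤ ‖S‖ * (‖T‖ * ‖f‖) := by gcongr; exact ContinuousLinearMap.le_opNorm _ _
    _ ≤ 1 / (1 - θ) * (θ * ‖f‖) := by gcongr
    _ = θ * ‖f‖ / (1 - θ) := by ring

variable {E : Type*} [NormedAddCommGroup E] [NormedSpace ℂ E]

/-- Analytic dependence on λ (p. 92: `V = g(i ad_{λ − H′D′(u₁,λ)}) − 1` with `D′(u₁, λ)` "analytic in λ"): if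
`λ ↦ T(λ)` is differentiable at `x` with `‖T x‖ < 1`, then `λ ↦ (I + T(λ))⁻¹ f` is differentiable at `x`
(differentiability of `Ring.inverse` at units).  Elementary API. [cite: Balaban1985RegularSpaces, p.92 (V after
(1.95)); analyticity sentence p.93 (after (1.102))] -/
theorem differentiableAt_inverse_one_add_apply {T : E → (F →L[ℂ] F)} {x : E}
    (hT : DifferentiableAt ℂ T x) (hx : ‖T x‖ < 1) (f : F) :
    DifferentiableAt ℂ (fun y => (1 + T y)⁻¹ʳ f) x := by
  have h1 : DifferentiableAt ℂ (fun y => (1 : F →L[ℂ] F) + T y) x := hT.const_add _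
  have h2 : DifferentiableAt ℂ (fun y => ((1 : F →L[ℂ] F) + T y)⁻¹ʳ) x :=
    h1.inverse (isUnit_one_add _ hx)
  exact h2.clm_apply (differentiableAt_const f)

end Neumann

/-! ## §4. Proposition 5 (p. 94) as printed: the transformation (1.100), the bound (1.101), the domain (1.102),
the conditions (1.103), the contraction estimate (1.106), and the unique fixed point with the bound (1.108). -/

section PropFive

variable {E F : Type*} [NormedAddCommGroup E] [NormedSpace ℂ E]
  [NormedAddCommGroup F] [NormedSpace ℂ F]

/-- **(1.101) derived.**  `𝔉(λ) := G′RD*A + G′R𝔉₄(λ, Dλ, A, D*A)` (1.100), typed as `𝔉 λ = G′(g₀ + Φ λ)` with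
`g₀` := `RD*A` and `Φ λ` := `R𝔉₄(λ, …)`.  From "G′ is a bounded operator from a space with the norm |·|₍₋₂₎ into a
space with the norm |·| for functions, and the norm |·|₍₋₁₎ for their first derivatives" (p. 93, `‖G′‖ ≤ B′₀`), the
first summand `|RD*A|₍₋₂₎ ≤ B₁(α₀+α₁)` and (1.99) `|R𝔉₄| ≤ C′₄B₁(α₀+α₁)α₄` on the domain (1.102) with `β = ½`:
"|𝔉(λ)| ≤ B′₀B₁(α₀+α₁) + B′₀C′₄B₁(α₀+α₁)α₄ … (1.101)".  (`E` carries the norm `max{|λ|, |Dλ|₍₋₁₎}`, so one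
inequality in `E` is both lines of (1.101); `s` := `α₀ + α₁`.)  The hypothesis `hΦ` is the printed remainder bound
(1.99). [cite: Balaban1985RegularSpaces, (1.101) p.93; (1.99)–(1.100), (1.102) p.93] -/
theorem ineq1101 (G' : F →L[ℂ] E) (g₀ : F) (Φ : E → F) {B₀' B₁ C₄' s α₄ : ℝ}
    (hG : ‖G'‖ ≤ B₀') (hg₀ : ‖g₀‖ ≤ B₁ * s)
    (h99 : ∀ lam ∈ ball (0 : E) (α₄ / 2), ‖Φ lam‖ ≤ C₄' * B₁ * s * α₄)
    {lam : E} (hlam : lam ∈ ball (0 : E) (α₄ / 2)) :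
    ‖G' (g₀ + Φ lam)‖ ≤ B₀' * B₁ * s + B₀' * C₄' * B₁ * s * α₄ := by
  have hB : 0 ≤ B₀' := (norm_nonneg _).trans hG
  calc ‖G' (g₀ + Φ lam)‖ ≤ ‖G'‖ * ‖g₀ + Φ lam‖ := G'.le_opNorm _
    _ ≤ B₀' * (‖g₀‖ + ‖Φ lam‖) := by
        have := norm_add_le g₀ (Φ lam)
        gcongr
    _ ≤ B₀' * (B₁ * s + C₄' * B₁ * s * α₄) := by
        have := h99 lam hlam
        gcongr
    _ = B₀' * B₁ * s + B₀' * C₄' * B₁ * s * α₄ := by ring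

/-- **(1.106) derived** (p. 94): for `λ₁, λ₂` in the domain (1.102) with `β = ¼` (here: its closure),
"|𝔉(λ₁) − 𝔉(λ₂)|, |D(𝔉(λ₁) − 𝔉(λ₂))|₍₋₁₎ ≤ B′₀C′₄B₁(α₀+α₁) 4 max{|λ₁−λ₂|, |Dλ₁−Dλ₂|₍₋₁₎}" — from the analyticity
of `Φ = R𝔉₄` on the domain with `β = ½` ("The function 𝔉 is obviously an analytic function in λ and we consider
configurations λ with values in the complexified algebra", p. 93), the bound (1.99) there, and the Cauchy estimate
of §2 with radius ratio `(½α₄ − ¼α₄)⁻¹ · C′₄B₁(α₀+α₁)α₄ = 4C′₄B₁(α₀+α₁)`. [cite: Balaban1985RegularSpaces,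
(1.104)–(1.106) pp.93–94; (1.99) p.93] -/
theorem ineq1106 (G' : F →L[ℂ] E) (g₀ : F) (Φ : E → F) {B₀' B₁ C₄' s α₄ : ℝ} (hα₄ : 0 < α₄)
    (hG : ‖G'‖ ≤ B₀')
    (hΦd : DifferentiableOn ℂ Φ (ball (0 : E) (α₄ / 2)))
    (h99 : ∀ lam ∈ ball (0 : E) (α₄ / 2), ‖Φ lam‖ ≤ C₄' * B₁ * s * α₄)
    {lam₁ lam₂ : E} (h₁ : ‖lam₁‖ ≤ α₄ / 4) (h₂ : ‖lam₂‖ ≤ α₄ / 4) :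
    ‖G' (g₀ + Φ lam₁) - G' (g₀ + Φ lam₂)‖ ≤ B₀' * C₄' * B₁ * s * 4 * ‖lam₁ - lam₂‖ := by
  have hB : 0 ≤ B₀' := (norm_nonneg _).trans hG
  have hlip := lipschitz_of_norm_le hΦd h99 (by linarith : α₄ / 4 < α₄ / 2) h₁ h₂
  have hcst : C₄' * B₁ * s * α₄ / (α₄ / 2 - α₄ / 4) = C₄' * B₁ * s * 4 := by
    field_simp
    ring
  rw [hcst] at hlip
  calc ‖G' (g₀ + Φ lam₁) - G' (g₀ + Φ lam₂)‖ = ‖G' (Φ lam₁ - Φ lam₂)‖ := by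
        rw [← map_sub]; congr 1; abel
    _ ≤ ‖G'‖ * ‖Φ lam₁ - Φ lam₂‖ := G'.le_opNorm _
    _ ≤ B₀' * (C₄' * B₁ * s * 4 * ‖lam₁ - lam₂‖) := by gcongr
    _ = B₀' * C₄' * B₁ * s * 4 * ‖lam₁ - lam₂‖ := by ring

/-- p. 94 l. 9: "and by (1.103) 4C′₄B′₀B₁(α₀+α₁) ≤ 2C′₄βα₄ = ½C′₄α₄ ≤ ½ for β = ¼" — the contraction constant of
(1.106) is at most `½` under (1.103) with `β = ¼` (printed as `2B′₀B₁(α₀+α₁) ≤ βα₄` and `C′₄α₄ ≤ 1`).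
Compare `B8.contraction_constant` (the same arithmetic at `α₄ = 8B′₀B₁(α₀+α₁)`). [cite: Balaban1985RegularSpaces,
p.94 l.9 (after (1.106)); (1.103) p.93] -/
theorem contraction_le_half {B₀' B₁ C₄' s α₄ : ℝ} (hC : 0 ≤ C₄')
    (h103a : C₄' * α₄ ≤ 1) (h103b : 2 * B₀' * B₁ * s ≤ (1 / 4) * α₄) :
    B₀' * C₄' * B₁ * s * 4 ≤ 1 / 2 := by
  have h1 : B₀' * C₄' * B₁ * s * 4 = 2 * C₄' * (2 * B₀' * B₁ * s) := by ring
  rw [h1]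
  nlinarith

/-- **Proposition 5, existence-and-uniqueness part, as an abstract theorem** (pp. 93–94).  Data: complex Banach
spaces `E` (configurations λ, norm `max{|λ|, |Dλ|₍₋₁₎}`) and `F` (norm `|·|₍₋₂₎`), `G′ : F → E` bounded by `B′₀`,
`g₀ = RD*A` with `|g₀|₍₋₂₎ ≤ B₁(α₀+α₁)`, `Φ = R𝔉₄(·, A, D*A)` analytic on the domain (1.102) with `β = ½` and bounded
there by (1.99); hypotheses (1.103) with `β = ¼` in the printed multiplied-out form `C′₄α₄ ≤ 1`,
`2B′₀B₁(α₀+α₁) ≤ ¼α₄`.  Conclusions: "the transformation 𝔉 maps the domain (1.102) with β = ¼ into itself and is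
contractive … there exists a unique fixed point of this transformation in the considered domain" — here on the
CLOSED domain `‖λ‖ ≤ ¼α₄` (the printed open domain and the non-strict (1.101), (1.103) leave the boundary case
`‖𝔉(λ)‖ = ¼α₄` undecided; on the closure nothing is lost, DIVERGENCE D-b08-g4.1) — and the fixed point obeys
`‖λ‖ ≤ 2B′₀B₁(α₀+α₁)` (so (1.108) `< 8B′₀B₁(α₀+α₁)` whenever `B′₀B₁(α₀+α₁) > 0`).  The fixed-point equation is
(1.100), the equivalent form (p.93: «Equations (1.95) can be changed into the equivalent equation (1.100)») of the
system (1.90) p.91 after the change of variables (1.93) and the Neumann inversion (1.94)–(1.96) p.92.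
[cite: Balaban1985RegularSpaces, Proposition 5 (1.107)–(1.108) p.94 (existence clause, abstract form); (1.100)
p.93; system (1.90) p.91 / (1.95) p.92] -/
theorem propFive_fixedPoint [CompleteSpace E] (G' : F →L[ℂ] E) (g₀ : F) (Φ : E → F)
    {B₀' B₁ C₄' s α₄ : ℝ}
    (hα₄ : 0 < α₄) (hB₁ : 0 ≤ B₁) (hs : 0 ≤ s) (hC : 0 ≤ C₄')
    (hG : ‖G'‖ ≤ B₀') (hg₀ : ‖g₀‖ ≤ B₁ * s)
    (hΦd : DifferentiableOn ℂ Φ (ball (0 : E) (α₄ / 2)))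
    (h99 : ∀ lam ∈ ball (0 : E) (α₄ / 2), ‖Φ lam‖ ≤ C₄' * B₁ * s * α₄)
    (h103a : C₄' * α₄ ≤ 1) (h103b : 2 * B₀' * B₁ * s ≤ (1 / 4) * α₄) :
    (∃! lam : E, ‖lam‖ ≤ α₄ / 4 ∧ G' (g₀ + Φ lam) = lam) ∧
      ∀ lam : E, ‖lam‖ ≤ α₄ / 4 → G' (g₀ + Φ lam) = lam → ‖lam‖ ≤ 2 * B₀' * B₁ * s := by
  have hB : 0 ≤ B₀' := (norm_nonneg _).trans hG
  -- image bound on the closed ¼-ball: (1.101) and `B′₀(1 + C′₄α₄)B₁s ≤ 2B′₀B₁s ≤ ¼α₄`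
  have hsub : ∀ lam : E, ‖lam‖ ≤ α₄ / 4 → lam ∈ ball (0 : E) (α₄ / 2) := fun lam h =>
    mem_ball_zero_iff.2 (by linarith)
  have himg : ∀ lam : E, ‖lam‖ ≤ α₄ / 4 → ‖G' (g₀ + Φ lam)‖ ≤ 2 * B₀' * B₁ * s := by
    intro lam h
    have h1 := ineq1101 G' g₀ Φ hG hg₀ h99 (hsub lam h)
    have h2 : B₀' * C₄' * B₁ * s * α₄ ≤ B₀' * B₁ * s := by
      have : B₀' * C₄' * B₁ * s * α₄ = (B₀' * B₁ * s) * (C₄' * α₄) := by ring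
      rw [this]
      have hp : 0 ≤ B₀' * B₁ * s := by positivity
      nlinarith
    linarith
  have hmaps : ∀ lam : E, ‖lam‖ ≤ α₄ / 4 → ‖G' (g₀ + Φ lam)‖ ≤ α₄ / 4 := fun lam h =>
    (himg lam h).trans (by linarith)
  have hκ := contraction_le_half (B₀' := B₀') (B₁ := B₁) (s := s) hC h103a h103b
  have hκ0 : 0 ≤ B₀' * C₄' * B₁ * s * 4 := by positivity
  have hlip : ∀ x y : E, ‖x‖ ≤ α₄ / 4 → ‖y‖ ≤ α₄ / 4 →
      ‖G' (g₀ + Φ x) - G' (g₀ + Φ y)‖ ≤ (B₀' * C₄' * B₁ * s * 4) * ‖x - y‖ := fun x y hx hy =>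
    ineq1106 G' g₀ Φ hα₄ hG hΦd h99 hx hy
  refine ⟨fixedPoint_closedBall (fun lam => G' (g₀ + Φ lam)) (by linarith) hκ0 (by linarith) hmaps hlip, ?_⟩
  intro lam h hfix
  exact norm_fixedPoint_le (fun lam => G' (g₀ + Φ lam)) himg h hfix

/-- **Proposition 5 with Bałaban's choice of α₄** (p. 94 l. 13–16: "To get best bounds on the solution we have to
take a smallest possible α₄, hence α₄ = 8B′₀B₁(α₀+α₁), and then we have to assume that α₀ + α₁ is so small that
all the conditions on α₀ + α₁, α₄ are satisfied"): with `α₄ = 8B′₀B₁(α₀+α₁)` the second condition of (1.103)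
(`β = ¼`) holds with equality, and the fixed point satisfies (1.108) "|λ|, |Dλ|₍₋₁₎ < 8B′₀B₁(α₀+α₁)" (indeed
`≤ 2B′₀B₁(α₀+α₁)`).  The remaining smallness `C′₄ · 8B′₀B₁(α₀+α₁) ≤ 1` is the hypothesis `hsmall` (one clause of
"α₀ + α₁ ≤ c₂"). [cite: Balaban1985RegularSpaces, (1.108) p.94; α₄-choice p.94 l.13–16] -/
theorem propFive_choice [CompleteSpace E] (G' : F →L[ℂ] E) (g₀ : F) (Φ : E → F) {B₀' B₁ C₄' s : ℝ}
    (hB₀ : 0 < B₀') (hB₁ : 0 < B₁) (hs : 0 < s) (hC : 0 ≤ C₄')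
    (hG : ‖G'‖ ≤ B₀') (hg₀ : ‖g₀‖ ≤ B₁ * s)
    (hΦd : DifferentiableOn ℂ Φ (ball (0 : E) (8 * B₀' * B₁ * s / 2)))
    (h99 : ∀ lam ∈ ball (0 : E) (8 * B₀' * B₁ * s / 2), ‖Φ lam‖ ≤ C₄' * B₁ * s * (8 * B₀' * B₁ * s))
    (hsmall : C₄' * (8 * B₀' * B₁ * s) ≤ 1) :
    (∃! lam : E, ‖lam‖ ≤ 2 * B₀' * B₁ * s ∧ G' (g₀ + Φ lam) = lam) ∧
      ∀ lam : E, ‖lam‖ ≤ 2 * B₀' * B₁ * s → G' (g₀ + Φ lam) = lam → ‖lam‖ < 8 * B₀' * B₁ * s := by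
  have hα₄ : 0 < 8 * B₀' * B₁ * s := by positivity
  have h103b : 2 * B₀' * B₁ * s ≤ (1 / 4) * (8 * B₀' * B₁ * s) := by linarith
  have hq : 8 * B₀' * B₁ * s / 4 = 2 * B₀' * B₁ * s := by ring
  obtain ⟨hex, hbd⟩ := propFive_fixedPoint G' g₀ Φ hα₄ hB₁.le hs.le hC hG hg₀ hΦd h99 hsmall h103b
  rw [hq] at hex hbd
  refine ⟨hex, fun lam h hfix => ?_⟩
  have := hbd lam h hfix
  have hp : 0 < B₀' * B₁ * s := by positivity
  linarith

end PropFive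

/-! ## §5. Sect. H, Theorem 8 (p. 101): the same contraction WITH A SOURCE TERM.  With the gauge condition
(1.146) `R(U₀)D*A = f` (`R(U₀)f = f`, `|f|₍₋₂₎ < γ(α₀+α₁)`) in place of (1.38), equation (1.93) reads
`[I + RVR]Δλ − … = f`, so after the Neumann inversion (1.95) acquires the right side `f̃(λ) := (I + RV(λ)R)⁻¹ f`
and (1.100) becomes `λ = G′f̃(λ) + G′RD*A + G′R𝔉₄(λ, …)` (`Q′λ = 0` still holds because `f̃(λ) ∈ Range R` and
`Q′G′R = 0` — this is where "f from the space R(U₀)" is used).  Printed claim: "Inspecting the proofs of the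
theorems and propositions we can see easily that they work in this more general situation almost without any
changes, only some constants change their numerical values." -/

section Source

variable {E F : Type*} [NormedAddCommGroup E] [NormedSpace ℂ E] [CompleteSpace E]
  [NormedAddCommGroup F] [NormedSpace ℂ F]

/-- **Sect. D with an abstract source term** (the inspection, step 1).  Besides the data of `propFive_fixedPoint`, a
map `N : E → F` (the source term `f̃(λ)`), analytic on the domain (1.102) with `β = ½`, with `‖N λ‖ ≤ ν` there and
with λ-dependent part `‖N λ − f‖ ≤ ν₁` there.  Then the source transformation `𝔉_f(λ) := G′(N λ + g₀ + Φ λ)`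
satisfies: (1.101)_f `‖𝔉_f(λ)‖ ≤ B′₀(ν + B₁s + C′₄B₁sα₄)`; (1.106)_f Lipschitz constant
`B′₀C′₄B₁s·4 + B′₀ν₁·4/α₄` on `‖λ‖ ≤ ¼α₄`; and under the MODIFIED conditions (1.103)_f — `C′₄α₄ ≤ ½`,
`2B′₀B₁s + B′₀ν ≤ ¼α₄`, `16B′₀ν₁ ≤ α₄` ("only some constants change their numerical values") — it has exactly one
fixed point in `‖λ‖ ≤ ¼α₄`, of norm `≤ B′₀ν + 2B′₀B₁s`. [cite: Balaban1985RegularSpaces, Sect. H p.101 («Inspecting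
the proofs … only some constants change their numerical values»); (1.100)–(1.106) pp.93–94] -/
theorem propFive_source (G' : F →L[ℂ] E) (g₀ f : F) (Φ N : E → F) {B₀' B₁ C₄' s α₄ ν ν₁ : ℝ}
    (hα₄ : 0 < α₄) (hB₁ : 0 ≤ B₁) (hs : 0 ≤ s) (hC : 0 ≤ C₄') (hν₁ : 0 ≤ ν₁)
    (hG : ‖G'‖ ≤ B₀') (hg₀ : ‖g₀‖ ≤ B₁ * s)
    (hΦd : DifferentiableOn ℂ Φ (ball (0 : E) (α₄ / 2)))
    (h99 : ∀ lam ∈ ball (0 : E) (α₄ / 2), ‖Φ lam‖ ≤ C₄' * B₁ * s * α₄)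
    (hNd : DifferentiableOn ℂ N (ball (0 : E) (α₄ / 2)))
    (hN : ∀ lam ∈ ball (0 : E) (α₄ / 2), ‖N lam‖ ≤ ν)
    (hN₁ : ∀ lam ∈ ball (0 : E) (α₄ / 2), ‖N lam - f‖ ≤ ν₁)
    (h103a : C₄' * α₄ ≤ 1 / 2) (h103b : 2 * B₀' * B₁ * s + B₀' * ν ≤ (1 / 4) * α₄)
    (h103c : 16 * B₀' * ν₁ ≤ α₄) :
    (∀ lam ∈ ball (0 : E) (α₄ / 2),
        ‖G' (N lam + g₀ + Φ lam)‖ ≤ B₀' * ν + B₀' * B₁ * s + B₀' * C₄' * B₁ * s * α₄) ∧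
    (∀ lam₁ lam₂ : E, ‖lam₁‖ ≤ α₄ / 4 → ‖lam₂‖ ≤ α₄ / 4 →
        ‖G' (N lam₁ + g₀ + Φ lam₁) - G' (N lam₂ + g₀ + Φ lam₂)‖ ≤
          (B₀' * C₄' * B₁ * s * 4 + B₀' * ν₁ * 4 / α₄) * ‖lam₁ - lam₂‖) ∧
    (B₀' * C₄' * B₁ * s * 4 + B₀' * ν₁ * 4 / α₄ ≤ 1 / 2) ∧
    (∃! lam : E, ‖lam‖ ≤ α₄ / 4 ∧ G' (N lam + g₀ + Φ lam) = lam) ∧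
    (∀ lam : E, ‖lam‖ ≤ α₄ / 4 → G' (N lam + g₀ + Φ lam) = lam →
        ‖lam‖ ≤ B₀' * ν + 2 * B₀' * B₁ * s) := by
  have hB : 0 ≤ B₀' := (norm_nonneg _).trans hG
  have hsub : ∀ lam : E, ‖lam‖ ≤ α₄ / 4 → lam ∈ ball (0 : E) (α₄ / 2) := fun lam h =>
    mem_ball_zero_iff.2 (by linarith)
  -- (1.101)_f
  have h101 : ∀ lam ∈ ball (0 : E) (α₄ / 2),
      ‖G' (N lam + g₀ + Φ lam)‖ ≤ B₀' * ν + B₀' * B₁ * s + B₀' * C₄' * B₁ * s * α₄ := by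
    intro lam hlam
    calc ‖G' (N lam + g₀ + Φ lam)‖ ≤ ‖G'‖ * ‖N lam + g₀ + Φ lam‖ := G'.le_opNorm _
      _ ≤ B₀' * (‖N lam‖ + ‖g₀‖ + ‖Φ lam‖) := by
          have := norm_add₃_le (a := N lam) (b := g₀) (c := Φ lam)
          gcongr
      _ ≤ B₀' * (ν + B₁ * s + C₄' * B₁ * s * α₄) := by
          have h1 := hN lam hlam
          have h2 := h99 lam hlam
          gcongr
      _ = B₀' * ν + B₀' * B₁ * s + B₀' * C₄' * B₁ * s * α₄ := by ring
  -- (1.106)_f : the source part through the Cauchy estimate applied to `N − f`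
  have hΨd : DifferentiableOn ℂ (fun lam => N lam - f) (ball (0 : E) (α₄ / 2)) :=
    hNd.sub (differentiableOn_const f)
  have h106 : ∀ lam₁ lam₂ : E, ‖lam₁‖ ≤ α₄ / 4 → ‖lam₂‖ ≤ α₄ / 4 →
      ‖G' (N lam₁ + g₀ + Φ lam₁) - G' (N lam₂ + g₀ + Φ lam₂)‖ ≤
        (B₀' * C₄' * B₁ * s * 4 + B₀' * ν₁ * 4 / α₄) * ‖lam₁ - lam₂‖ := by
    intro lam₁ lam₂ h₁ h₂
    have hq : α₄ / 4 < α₄ / 2 := by linarith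
    have hΦlip := lipschitz_of_norm_le hΦd h99 hq h₁ h₂
    have hNlip := lipschitz_of_norm_le hΨd hN₁ hq h₁ h₂
    have hc1 : C₄' * B₁ * s * α₄ / (α₄ / 2 - α₄ / 4) = C₄' * B₁ * s * 4 := by
      field_simp
      ring
    have hc2 : ν₁ / (α₄ / 2 - α₄ / 4) = ν₁ * 4 / α₄ := by
      field_simp
      ring
    rw [hc1] at hΦlip
    rw [hc2] at hNlip
    have hNlip' : ‖N lam₁ - N lam₂‖ ≤ ν₁ * 4 / α₄ * ‖lam₁ - lam₂‖ := by
      have : N lam₁ - f - (N lam₂ - f) = N lam₁ - N lam₂ := by abel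
      rw [this] at hNlip
      exact hNlip
    calc ‖G' (N lam₁ + g₀ + Φ lam₁) - G' (N lam₂ + g₀ + Φ lam₂)‖
        = ‖G' ((N lam₁ - N lam₂) + (Φ lam₁ - Φ lam₂))‖ := by
          rw [← map_sub]; congr 1; abel
      _ ≤ ‖G'‖ * ‖(N lam₁ - N lam₂) + (Φ lam₁ - Φ lam₂)‖ := G'.le_opNorm _
      _ ≤ B₀' * (‖N lam₁ - N lam₂‖ + ‖Φ lam₁ - Φ lam₂‖) := by
          have := norm_add_le (N lam₁ - N lam₂) (Φ lam₁ - Φ lam₂)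
          gcongr
      _ ≤ B₀' * (ν₁ * 4 / α₄ * ‖lam₁ - lam₂‖ + C₄' * B₁ * s * 4 * ‖lam₁ - lam₂‖) := by
          gcongr
      _ = (B₀' * C₄' * B₁ * s * 4 + B₀' * ν₁ * 4 / α₄) * ‖lam₁ - lam₂‖ := by ring
  -- the modified contraction constant is ≤ ½
  have hν0 : 0 ≤ ν := (norm_nonneg _).trans (hN 0 (mem_ball_self (by linarith)))
  have hκ : B₀' * C₄' * B₁ * s * 4 + B₀' * ν₁ * 4 / α₄ ≤ 1 / 2 := by
    have h1 : B₀' * C₄' * B₁ * s * 4 ≤ 1 / 4 := by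
      have e : B₀' * C₄' * B₁ * s * 4 = 2 * C₄' * (2 * B₀' * B₁ * s) := by ring
      rw [e]
      have hp : 2 * B₀' * B₁ * s ≤ (1 / 4) * α₄ := by nlinarith
      nlinarith
    have h2 : B₀' * ν₁ * 4 / α₄ ≤ 1 / 4 := by
      rw [div_le_iff₀ hα₄]
      linarith
    linarith
  have hκ0 : 0 ≤ B₀' * C₄' * B₁ * s * 4 + B₀' * ν₁ * 4 / α₄ := by positivity
  -- invariance of the closed ¼-ball
  have himg : ∀ lam : E, ‖lam‖ ≤ α₄ / 4 → ‖G' (N lam + g₀ + Φ lam)‖ ≤ B₀' * ν + 2 * B₀' * B₁ * s := by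
    intro lam h
    have h1 := h101 lam (hsub lam h)
    have h2 : B₀' * C₄' * B₁ * s * α₄ ≤ B₀' * B₁ * s := by
      have e : B₀' * C₄' * B₁ * s * α₄ = (B₀' * B₁ * s) * (C₄' * α₄) := by ring
      rw [e]
      have hp : 0 ≤ B₀' * B₁ * s := by positivity
      nlinarith
    linarith
  have hmaps : ∀ lam : E, ‖lam‖ ≤ α₄ / 4 → ‖G' (N lam + g₀ + Φ lam)‖ ≤ α₄ / 4 := fun lam h =>
    (himg lam h).trans (by linarith)
  refine ⟨h101, h106, hκ, fixedPoint_closedBall (fun lam => G' (N lam + g₀ + Φ lam)) (by linarith) hκ0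
    (by linarith) hmaps h106, ?_⟩
  intro lam h hfix
  exact norm_fixedPoint_le (fun lam => G' (N lam + g₀ + Φ lam)) himg h hfix

variable [CompleteSpace F]

/-- **Theorem 8, Sect. D part, by inspection with explicit constants** (the inspection, step 2: the source term IS
the Neumann inverse of p. 92 applied to `f`).  Data in printed shape: `‖G′‖ ≤ B′₀` (p. 93); `g₀ = RD*A`,
`|g₀|₍₋₂₎ ≤ B₁(α₀+α₁)`; `Φ = R𝔉₄` analytic with (1.99) on the domain (1.102), `β = ½`; (1.98): `‖R‖ ≤ B′₀` and
`‖V(λ)‖ ≤ c_V α₄` with `V` analytic in λ on the same domain; the source `f` with `|f|₍₋₂₎ ≤ γ(α₀+α₁)` (p. 101: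
"|f|₍₋₂₎ < γ(α₀+α₁) with a positive, not too big, constant γ, e.g. γ = 1").  CHANGED CONSTANTS: `α₄` is taken
`= 8B′₀(B₁ + γ)(α₀+α₁)` instead of `8B′₀B₁(α₀+α₁)`; the printed "O(α₄)B′₀² ≤ ½" becomes `θ := B′₀²c_Vα₄ ≤ ¼`; the
printed "C′₄α₄ ≤ 1" becomes `≤ ½` — three numerical conditions on `α₀ + α₁` whose thresholds depend on `γ`
("the constant c₁ depends on d, L and γ").  CONCLUSION: the source transformation
`𝔉_f(λ) = G′((I + RV(λ)R)⁻¹f + RD*A + R𝔉₄(λ, …))` has exactly one fixed point with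
`‖λ‖ ≤ ¼α₄ = 2B′₀(B₁+γ)(α₀+α₁)` — (1.108) with `B₁ ↦ B₁ + γ`.  No smallness of `γ` is needed for THIS step.
[cite: Balaban1985RegularSpaces, Theorem 8 p.101 (Sect. D part, by inspection); (1.146) p.101; (1.96)–(1.98) p.92;
(1.108) p.94] -/
theorem thm8_sectD_inspected (G' : F →L[ℂ] E) (R : F →L[ℂ] F) (V : E → (F →L[ℂ] F)) (g₀ f : F) (Φ : E → F)
    {B₀' B₁ C₄' c_V γ s α₄ : ℝ}
    (hB₀ : 0 < B₀') (hB₁ : 0 < B₁) (hγ : 0 ≤ γ) (hs : 0 < s) (hC : 0 ≤ C₄') (hcV : 0 ≤ c_V)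
    (hα₄ : α₄ = 8 * B₀' * (B₁ + γ) * s)
    (hG : ‖G'‖ ≤ B₀') (hg₀ : ‖g₀‖ ≤ B₁ * s)
    (hΦd : DifferentiableOn ℂ Φ (ball (0 : E) (α₄ / 2)))
    (h99 : ∀ lam ∈ ball (0 : E) (α₄ / 2), ‖Φ lam‖ ≤ C₄' * B₁ * s * α₄)
    (hR : ‖R‖ ≤ B₀') (hVd : DifferentiableOn ℂ V (ball (0 : E) (α₄ / 2)))
    (h98 : ∀ lam ∈ ball (0 : E) (α₄ / 2), ‖V lam‖ ≤ c_V * α₄)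
    (hf : ‖f‖ ≤ γ * s)
    (hθ : B₀' ^ 2 * c_V * α₄ ≤ 1 / 4) (h103a : C₄' * α₄ ≤ 1 / 2) :
    (∀ lam ∈ ball (0 : E) (α₄ / 2), IsUnit (1 + R.comp ((V lam).comp R))) ∧
    (∃! lam : E, ‖lam‖ ≤ α₄ / 4 ∧
        G' ((1 + R.comp ((V lam).comp R))⁻¹ʳ f + g₀ + Φ lam) = lam) ∧
    α₄ / 4 = 2 * B₀' * (B₁ + γ) * s ∧
    (∀ lam : E, ‖lam‖ ≤ α₄ / 4 → ‖lam‖ < 8 * B₀' * (B₁ + γ) * s) := by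
  have hα₄pos : 0 < α₄ := by rw [hα₄]; positivity
  set θ : ℝ := B₀' ^ 2 * c_V * α₄ with hθdef
  have hθ0 : 0 ≤ θ := by positivity
  have hθ1 : θ < 1 := by linarith
  -- (1.98) ⇒ ‖RV(λ)R‖ ≤ B′₀² c_V α₄ = θ
  have hT : ∀ lam ∈ ball (0 : E) (α₄ / 2), ‖R.comp ((V lam).comp R)‖ ≤ θ := by
    intro lam hlam
    calc ‖R.comp ((V lam).comp R)‖ ≤ ‖R‖ * ‖(V lam).comp R‖ := ContinuousLinearMap.opNorm_comp_le _ _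
      _ ≤ ‖R‖ * (‖V lam‖ * ‖R‖) := by gcongr; exact ContinuousLinearMap.opNorm_comp_le _ _
      _ ≤ B₀' * (c_V * α₄ * B₀') := by
          have h1 := h98 lam hlam
          have hR0 : 0 ≤ ‖R‖ := norm_nonneg _
          have hV0 : 0 ≤ ‖V lam‖ := norm_nonneg _
          calc ‖R‖ * (‖V lam‖ * ‖R‖) ≤ B₀' * (‖V lam‖ * ‖R‖) := by gcongr
            _ ≤ B₀' * (c_V * α₄ * B₀') := by gcongr
      _ = θ := by rw [hθdef]; ring
  have hunit : ∀ lam ∈ ball (0 : E) (α₄ / 2), IsUnit (1 + R.comp ((V lam).comp R)) := fun lam hlam =>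
    isUnit_one_add _ (lt_of_le_of_lt (hT lam hlam) hθ1)
  -- the source term N(λ) := (I + RV(λ)R)⁻¹ f and its bounds ν, ν₁
  set N : E → F := fun lam => (1 + R.comp ((V lam).comp R))⁻¹ʳ f with hNdef
  have hN : ∀ lam ∈ ball (0 : E) (α₄ / 2), ‖N lam‖ ≤ γ * s / (1 - θ) := by
    intro lam hlam
    have h := norm_inverse_one_add_apply_le _ (hT lam hlam) hθ1 f
    refine h.trans ?_
    exact div_le_div_of_nonneg_right hf (by linarith)
  have hN₁ : ∀ lam ∈ ball (0 : E) (α₄ / 2), ‖N lam - f‖ ≤ θ * (γ * s) / (1 - θ) := by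
    intro lam hlam
    have h := norm_inverse_one_add_apply_sub_le _ (hT lam hlam) hθ1 f
    refine h.trans ?_
    apply div_le_div_of_nonneg_right _ (by linarith)
    exact mul_le_mul_of_nonneg_left hf hθ0
  have hNd : DifferentiableOn ℂ N (ball (0 : E) (α₄ / 2)) := by
    intro lam hlam
    have hVlam : DifferentiableAt ℂ V lam := hVd.differentiableAt (isOpen_ball.mem_nhds hlam)
    have hTd : DifferentiableAt ℂ (fun y => R.comp ((V y).comp R)) lam :=
      (differentiableAt_const R).clm_comp (hVlam.clm_comp (differentiableAt_const R))
    exact (differentiableAt_inverse_one_add_apply hTd (lt_of_le_of_lt (hT lam hlam) hθ1) f).differentiableWithinAt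
  -- the three modified conditions (1.103)_f
  have hν₁0 : 0 ≤ θ * (γ * s) / (1 - θ) := by
    apply div_nonneg _ (by linarith)
    positivity
  have h103b : 2 * B₀' * B₁ * s + B₀' * (γ * s / (1 - θ)) ≤ (1 / 4) * α₄ := by
    -- `γ s/(1−θ) ≤ 2γ s` because `θ ≤ ¼ ≤ ½`
    have h1 : γ * s / (1 - θ) ≤ 2 * (γ * s) := by
      rw [div_le_iff₀ (by linarith)]
      have hp : 0 ≤ γ * s := by positivity
      nlinarith
    have h2 : B₀' * (γ * s / (1 - θ)) ≤ B₀' * (2 * (γ * s)) := mul_le_mul_of_nonneg_left h1 hB₀.le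
    rw [hα₄]
    nlinarith
  have h103c : 16 * B₀' * (θ * (γ * s) / (1 - θ)) ≤ α₄ := by
    -- `θ γ s/(1−θ) ≤ (4/3)θ γ s ≤ γ s/3`, and `16 B′₀ γ s/3 ≤ 8B′₀(B₁+γ)s`
    have h1 : θ * (γ * s) / (1 - θ) ≤ (1 / 3) * (γ * s) := by
      rw [div_le_iff₀ (by linarith)]
      have hp : 0 ≤ γ * s := by positivity
      nlinarith
    have h2 : 16 * B₀' * (θ * (γ * s) / (1 - θ)) ≤ 16 * B₀' * ((1 / 3) * (γ * s)) :=
      mul_le_mul_of_nonneg_left h1 (by positivity)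
    rw [hα₄]
    have hp : 0 ≤ B₀' * B₁ * s := by positivity
    nlinarith
  obtain ⟨-, -, -, hex, -⟩ := propFive_source G' g₀ f Φ N hα₄pos hB₁.le hs.le hC hν₁0 hG hg₀ hΦd h99 hNd hN hN₁
    h103a h103b h103c
  refine ⟨hunit, ?_, by rw [hα₄]; ring, fun lam h => ?_⟩
  · simpa [hNdef] using hex
  · have hp : 0 < B₀' * (B₁ + γ) * s := by positivity
    rw [hα₄] at h
    linarith

end Source

/-! ## §6. Why "B₁ as in Theorems 2, 4" is compatible with "γ not too big" (Sect. B–C a-priori algebra with a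
source).  The printed (1.60) ⇒ (1.62) step (`B8.apriori_160`, `B8.apriori_162`: every norm `≤ B₀(J + B)`-bound
`⇒ ≤ B₀(4α₀ + 4dLα₁ + […]) ≤ 5dLB₀(α₀+α₁)` under (1.61)) has the slack `(dL − 1)(5α₀ + α₁)`.  IF a source enters
(1.59) additively as `B₀·φ` (the SHAPE forced by a `|G D f|`-type term bounded through (3.42) of [4]; the paper
displays no (1.59) with source, so this shape and the size of `φ` are HYPOTHESES here), the bootstrap doubles it
and `B₁ = 5dLB₀` survives exactly when `2φ ≤ (dL − 1)(α₀ + α₁)`; for `φ = cγ(α₀+α₁)` this is `2cγ ≤ dL − 1`. -/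

section Slack

/-- (1.59)–(1.60) with an additive source contribution `B₀φ`: the printed bootstrap of p. 86 ("Let us take this
bound for |∇^η_{U₀}A|₍₋₂₎ on the left-hand side, and let us assume that B₀36dα₂ ≦ 1/2. This gives us a bound for
|∇^η_{U₀}A|₍₋₂₎, equal to the right-hand side above without this term and multiplied by 2.") gives every norm
`≤ B₀(4α₀ + 4dLα₁ + 2α₂² + 20dα₀α₂ + 2C₂α₂² + 2φ)`.  Compare `B8.apriori_160` (φ = 0); the additive source entry is a
hypothesised shape (Sect. H prints no formula). [cite: Balaban1985RegularSpaces, (1.59)–(1.60) p.86; Sect. H p.101] -/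
theorem apriori_160_source {d L C₂ B₀ α₀ α₁ α₂ nJ nB φ a g j₂ l : ℝ}
    (hd : 0 ≤ d) (hB₀ : 0 ≤ B₀) (hα₂ : 0 ≤ α₂) (hg : 0 ≤ g)
    (h55 : nJ ≤ 2 * α₀ + 36 * d * α₂ * g + 50 * d * α₂ ^ 3 + 10 * d * α₀ * α₂)
    (h56 : nB ≤ 2 * d * L * α₁ + C₂ * α₂ ^ 2)
    (h59a : a ≤ B₀ * (nJ + nB) + B₀ * φ) (h59g : g ≤ B₀ * (nJ + nB) + B₀ * φ)
    (h59j : j₂ ≤ B₀ * (nJ + nB) + B₀ * φ) (h59l : l ≤ B₀ * (nJ + nB) + B₀ * φ)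
    (hside : 36 * d * B₀ * α₂ ≤ 1 / 2) (h50 : 50 * d * α₂ ≤ 1) :
    a ≤ B₀ * (4 * α₀ + 4 * d * L * α₁ + 2 * α₂ ^ 2 + 20 * d * α₀ * α₂ + 2 * C₂ * α₂ ^ 2 + 2 * φ) ∧
    g ≤ B₀ * (4 * α₀ + 4 * d * L * α₁ + 2 * α₂ ^ 2 + 20 * d * α₀ * α₂ + 2 * C₂ * α₂ ^ 2 + 2 * φ) ∧
    j₂ ≤ B₀ * (4 * α₀ + 4 * d * L * α₁ + 2 * α₂ ^ 2 + 20 * d * α₀ * α₂ + 2 * C₂ * α₂ ^ 2 + 2 * φ) ∧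
    l ≤ B₀ * (4 * α₀ + 4 * d * L * α₁ + 2 * α₂ ^ 2 + 20 * d * α₀ * α₂ + 2 * C₂ * α₂ ^ 2 + 2 * φ) := by
  set Y := 2 * α₀ + 50 * d * α₂ ^ 3 + 10 * d * α₀ * α₂ + nB + φ with hY
  have hJB : nJ + nB + φ ≤ Y + 36 * d * α₂ * g := by rw [hY]; linarith
  have hstep : B₀ * (nJ + nB) + B₀ * φ ≤ B₀ * Y + 36 * d * B₀ * α₂ * g := by
    have := mul_le_mul_of_nonneg_left hJB hB₀
    linarith [this]
  have hθg : 36 * d * B₀ * α₂ * g ≤ (1 / 2) * g := by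
    have := mul_le_mul_of_nonneg_right hside hg
    linarith [this]
  have hg2 : g ≤ 2 * (B₀ * Y) := by linarith
  have hall : ∀ x, x ≤ B₀ * (nJ + nB) + B₀ * φ → x ≤ 2 * (B₀ * Y) := fun x hx => by linarith
  have hdα : 0 ≤ d * α₂ := mul_nonneg hd hα₂
  have hcube : 100 * d * α₂ ^ 3 ≤ 2 * α₂ ^ 2 := by nlinarith [sq_nonneg α₂, hdα]
  have hfin : 2 * (B₀ * Y) ≤
      B₀ * (4 * α₀ + 4 * d * L * α₁ + 2 * α₂ ^ 2 + 20 * d * α₀ * α₂ + 2 * C₂ * α₂ ^ 2 + 2 * φ) := by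
    have hin : 2 * Y ≤
        4 * α₀ + 4 * d * L * α₁ + 2 * α₂ ^ 2 + 20 * d * α₀ * α₂ + 2 * C₂ * α₂ ^ 2 + 2 * φ := by
      rw [hY]; linarith
    have := mul_le_mul_of_nonneg_left hin hB₀
    linarith [this]
  exact ⟨(hall a h59a).trans hfin, hg2.trans hfin, (hall j₂ h59j).trans hfin, (hall l h59l).trans hfin⟩

/-- (1.60)_f ⇒ (1.62) with the UNCHANGED `B₁ = 5dLB₀` (p. 87), provided the source contribution fits the slack:
`2φ ≤ (dL − 1)(α₀ + α₁)`.  Compare `B8.apriori_162` (φ = 0). [cite: Balaban1985RegularSpaces, (1.62) p.87 («B₁ =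
5dLB₀»); Sect. H p.101 («B₁, B₂(β₀) are as in Theorems 2, 4»)] -/
theorem apriori_162_source {d L C₂ B₀ α₀ α₁ α₂ φ : ℝ} (hB₀ : 0 ≤ B₀) (hdL : 1 ≤ d * L) (hα₀ : 0 ≤ α₀)
    (h61 : 2 * α₂ ^ 2 + 20 * d * α₀ * α₂ + 2 * C₂ * α₂ ^ 2 ≤ α₀ + α₁)
    (hslack : 2 * φ ≤ (d * L - 1) * (α₀ + α₁)) :
    B₀ * (4 * α₀ + 4 * d * L * α₁ + 2 * α₂ ^ 2 + 20 * d * α₀ * α₂ + 2 * C₂ * α₂ ^ 2 + 2 * φ) ≤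
      5 * d * L * B₀ * (α₀ + α₁) := by
  have h : 4 * α₀ + 4 * d * L * α₁ + 2 * α₂ ^ 2 + 20 * d * α₀ * α₂ + 2 * C₂ * α₂ ^ 2 + 2 * φ ≤
      5 * d * L * (α₀ + α₁) := by
    nlinarith [mul_nonneg (sub_nonneg.2 hdL) hα₀]
  calc B₀ * (4 * α₀ + 4 * d * L * α₁ + 2 * α₂ ^ 2 + 20 * d * α₀ * α₂ + 2 * C₂ * α₂ ^ 2 + 2 * φ)
      ≤ B₀ * (5 * d * L * (α₀ + α₁)) := mul_le_mul_of_nonneg_left h hB₀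
    _ = 5 * d * L * B₀ * (α₀ + α₁) := by ring

/-- The γ-reading: with `φ = cγ(α₀+α₁)` (`c` = the unspecified O(1) of the source entry in (1.59)), `B₁ = 5dLB₀`
survives iff-sufficiently `2cγ ≤ dL − 1` — a precise sense of "positive, not too big, constant γ" under which "the
constants B₁, B₂(β₀) are as in Theorems 2, 4" (p. 101).  For `d = 4`, `L ≥ 2` and `c = 1` this allows `γ ≤ 7/2`,
in particular "e.g. γ = 1". [cite: Balaban1985RegularSpaces, Sect. H p.101 («|f|₍₋₂₎ < γ(α₀+α₁) … e.g. γ = 1»);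
(1.62) p.87] -/
theorem apriori_162_gamma {d L C₂ B₀ α₀ α₁ α₂ c γ : ℝ} (hB₀ : 0 ≤ B₀) (hdL : 1 ≤ d * L) (hα₀ : 0 ≤ α₀)
    (hα₁ : 0 ≤ α₁)
    (h61 : 2 * α₂ ^ 2 + 20 * d * α₀ * α₂ + 2 * C₂ * α₂ ^ 2 ≤ α₀ + α₁)
    (hγ : 2 * c * γ ≤ d * L - 1) :
    B₀ * (4 * α₀ + 4 * d * L * α₁ + 2 * α₂ ^ 2 + 20 * d * α₀ * α₂ + 2 * C₂ * α₂ ^ 2 +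
        2 * (c * γ * (α₀ + α₁))) ≤ 5 * d * L * B₀ * (α₀ + α₁) := by
  apply apriori_162_source hB₀ hdL hα₀ h61
  have hs : 0 ≤ α₀ + α₁ := by linarith
  nlinarith [mul_le_mul_of_nonneg_right hγ hs]

/-- Numerical instance of the γ-window: `d = 4`, `L = 2`, `c = 1`, `γ = 1` gives `2cγ = 2 ≤ dL − 1 = 7`
("e.g. γ = 1", p. 101). [cite: Balaban1985RegularSpaces, Sect. H p.101] -/
theorem gamma_window_d4_L2 : 2 * (1 : ℝ) * 1 ≤ 4 * 2 - 1 := by norm_num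

end Slack

end Literature.MathematicalPhysics.QuantumFieldTheory.Balaban1983to89.B8SectDSource
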